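import Summits.AtomisticToContinuum.FouriersLaw.Theses.HonestZwanzig
import Summits.AtomisticToContinuum.FouriersLaw.Theorems.JunctionLocalityNonBallisticStubColumnFlatGreenKuboAux1
import Literature.MathematicalPhysics.KineticTheory.ChainReflection

/-!
# `HonestZwanzig.GeneratorSiteEnergy` (stmt-AtomisticToContinuum-12698): the local energy balance `L e_x = ∇·j + baths`

Item `GeneratorSiteEnergy` of route `HonestZwanzig` (sub-problem `FouriersLaw`): for the pinned anharmonic chain
`P = pinnedChain ω₂ lam β γ` (all real parameters), `N ≥ 2`, bath temperatures `T_L, T_R` and EVERY site `x`, the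
symmetrically split site energy `e_x = p_x²/2 + U(q_x) + ½V(q_{x+1} − q_x) + ½V(q_x − q_{x−1})` (boundary bonds absent)
satisfies, pointwise,

  `L e_x = j_{x−1} − j_x + [x = 0] γ(T_L − p_0²) + [x = N−1] γ(T_R − p²_{N−1})`

with BLR's bond current `j_b = −½(p_b + p_{b+1})V′(q_{b+1} − q_b)` (`OscillatorChain.bondCurrent`; `j_{−1} := 0`,
`j_{N−1} ≡ 0`). Three cases: the left bath site (`generator_siteEnergy`, landed with the bath-bond reduction of crux
stmt-9120), an interior site (`generator_splitSiteEnergy`, landed with stub (CF) of crux stmt-9127), and the right bath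
site (`generator_rightSiteEnergy`, below: `∂_{q_{N−1}}H = U′ + V′(q_{N−1} − q_{N−2})`, right Ornstein–Uhlenbeck term). The
item's `Fin N`-sums over neighbours are reduced to these closed forms by `sum_ite_val_succ_eq` / `sum_ite_val_pred_eq`.
-/

noncomputable section

open MeasureTheory Filter Topology Set Finset
open Literature.MathematicalPhysics.KineticTheory.HeatConduction

namespace Summit.AtomisticToContinuum.FouriersLaw.Theorems.HonestZwanzig

open Summit.AtomisticToContinuum.FouriersLaw.Theorems.SubdiffusiveBondHeat
open Summit.AtomisticToContinuum.FouriersLaw.Theorems.NonBallistic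

variable {N : ℕ}

/-! ### Neighbour sums over `Fin N` -/

section Sums

variable {M : Type*} [AddCommMonoid M]

/-- `Σ_j [j = x+1] F j = F c` when `c = x + 1` is a site. [folklore] -/
theorem sum_ite_val_succ_eq {x c : Fin N} (hc : c.val = x.val + 1) (F : Fin N → M) :
    ∑ j : Fin N, (if j.val = x.val + 1 then F j else 0) = F c := by
  rw [Finset.sum_eq_single c]
  · rw [if_pos hc]
  · intro j _ hj
    have : ¬ (j.val = x.val + 1) := fun h => hj (Fin.ext (by omega))
    rw [if_neg this]
  · intro h; exact absurd (Finset.mem_univ _) h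

/-- `Σ_j [j = x+1] F j = 0` when `x` is the last site. [folklore] -/
theorem sum_ite_val_succ_eq_zero {x : Fin N} (hx : x.val + 1 = N) (F : Fin N → M) :
    ∑ j : Fin N, (if j.val = x.val + 1 then F j else 0) = 0 := by
  refine Finset.sum_eq_zero fun j _ => ?_
  have : ¬ (j.val = x.val + 1) := fun h => by have := j.isLt; omega
  rw [if_neg this]

/-- `Σ_j [x = j+1] F j = F a` when `x = a + 1`. [folklore] -/
theorem sum_ite_val_pred_eq {x a : Fin N} (ha : x.val = a.val + 1) (F : Fin N → M) :
    ∑ j : Fin N, (if x.val = j.val + 1 then F j else 0) = F a := by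
  rw [Finset.sum_eq_single a]
  · rw [if_pos ha]
  · intro j _ hj
    have : ¬ (x.val = j.val + 1) := fun h => hj (Fin.ext (by omega))
    rw [if_neg this]
  · intro h; exact absurd (Finset.mem_univ _) h

/-- `Σ_j [x = j+1] F j = 0` when `x` is the first site. [folklore] -/
theorem sum_ite_val_pred_eq_zero {x : Fin N} (hx : x.val = 0) (F : Fin N → M) :
    ∑ j : Fin N, (if x.val = j.val + 1 then F j else 0) = 0 := by
  refine Finset.sum_eq_zero fun j _ => ?_
  have : ¬ (x.val = j.val + 1) := fun h => by omega
  rw [if_neg this]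

end Sums

/-! ### The right bath site: coordinate derivatives and the generator identity -/

section RightSite

variable (P : OscillatorChain) {a b : Fin N}

/-- `∂_{p_i} e = [i = b] p_b` for `e = p_b²/2 + U(q_b) + ½V(q_b − q_a)`. [folklore] -/
theorem partialP_rightSiteEnergy (i : Fin N) (y : PhaseSpace N) :
    partialP i (fun z : PhaseSpace N => (z.2 b) ^ 2 / 2 + P.U (z.1 b) + P.V (z.1 b - z.1 a) / 2) y =
      if i = b then y.2 b else 0 := by
  unfold partialP
  by_cases hi : i = b
  · subst hi
    simp only [Function.update_self, if_true]
    have h : HasDerivAt (fun t : ℝ => t ^ 2 / 2 + P.U (y.1 i) + P.V (y.1 i - y.1 a) / 2) (y.2 i) (y.2 i) := by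
      have h1 := ((hasDerivAt_pow 2 (y.2 i)).div_const 2).add_const (P.U (y.1 i) + P.V (y.1 i - y.1 a) / 2)
      refine (h1.congr_deriv ?_).congr_of_eventuallyEq ?_
      · push_cast; ring
      · exact Eventually.of_forall fun t => by ring
    exact h.deriv
  · have hne : b ≠ i := Ne.symm hi
    simp only [hi, if_false, Function.update_of_ne hne, deriv_const']

/-- `∂_{p_i} e` as a function. [folklore] -/
theorem partialP_rightSiteEnergy_eq (i : Fin N) :
    partialP i (fun z : PhaseSpace N => (z.2 b) ^ 2 / 2 + P.U (z.1 b) + P.V (z.1 b - z.1 a) / 2) =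
      fun y => if i = b then y.2 b else 0 :=
  funext fun y => partialP_rightSiteEnergy P i y

/-- `∂²_{p_i} e = [i = b]`. [folklore] -/
theorem partialP_partialP_rightSiteEnergy (i : Fin N) (y : PhaseSpace N) :
    partialP i (partialP i (fun z : PhaseSpace N => (z.2 b) ^ 2 / 2 + P.U (z.1 b) + P.V (z.1 b - z.1 a) / 2)) y =
      if i = b then 1 else 0 := by
  rw [partialP_rightSiteEnergy_eq P i]
  unfold partialP
  by_cases hi : i = b
  · subst hi
    simp only [if_true, Function.update_self]
    exact (hasDerivAt_id' (y.2 i)).deriv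
  · simp only [hi, if_false, deriv_const']

/-- `∂_{q_i} e = [i = b] U′(q_b) + ½V′(q_b − q_a)([i = b] − [i = a])` for differentiable `U, V`. [folklore] -/
theorem partialQ_rightSiteEnergy (hU : Differentiable ℝ P.U) (hV : Differentiable ℝ P.V) (i : Fin N)
    (y : PhaseSpace N) :
    partialQ i (fun z : PhaseSpace N => (z.2 b) ^ 2 / 2 + P.U (z.1 b) + P.V (z.1 b - z.1 a) / 2) y =
      (if i = b then deriv P.U (y.1 b) else 0) +
        deriv P.V (y.1 b - y.1 a) / 2 * ((if i = b then 1 else 0) - (if i = a then 1 else 0)) := by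
  unfold partialQ
  have hq : ∀ k : Fin N, HasDerivAt (fun t : ℝ => Function.update y.1 i t k) (if i = k then 1 else 0) (y.1 i) := by
    intro k
    by_cases hk : i = k
    · subst hk; simp only [Function.update_self, if_true]; exact hasDerivAt_id _
    · simp only [Function.update_of_ne (Ne.symm hk), hk, if_false]; exact hasDerivAt_const _ _
  have hpt : ∀ k : Fin N, Function.update y.1 i (y.1 i) k = y.1 k := fun k => by
    rw [Function.update_eq_self]
  have hUb : HasDerivAt (fun t => P.U (Function.update y.1 i t b))
      (deriv P.U (y.1 b) * (if i = b then 1 else 0)) (y.1 i) := by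
    have h := (hU (Function.update y.1 i (y.1 i) b)).hasDerivAt.comp (y.1 i) (hq b)
    rw [hpt] at h
    exact h
  have hVba : HasDerivAt (fun t => P.V (Function.update y.1 i t b - Function.update y.1 i t a))
      (deriv P.V (y.1 b - y.1 a) * ((if i = b then 1 else 0) - (if i = a then 1 else 0))) (y.1 i) := by
    have h := (hV (Function.update y.1 i (y.1 i) b - Function.update y.1 i (y.1 i) a)).hasDerivAt.comp
      (y.1 i) ((hq b).sub (hq a))
    rw [hpt, hpt] at h
    exact h
  have hconst : HasDerivAt (fun _ : ℝ => (y.2 b) ^ 2 / 2) 0 (y.1 i) := hasDerivAt_const _ _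
  have h := (hconst.add hUb).add (hVba.div_const 2)
  refine h.deriv.trans ?_
  split_ifs <;> ring

/-- `∂_{q_b} H = U′(q_b) + V′(q_b − q_a)` at the right end `b = N − 1 = a + 1` (only the bond `(a, b)` touches the last
site). [folklore] -/
theorem dPotential_last (hab : b.val = a.val + 1) (hbN : b.val + 1 = N) (q : Fin N → ℝ) :
    P.dPotential N b q = deriv P.U (q b) + deriv P.V (q b - q a) := by
  unfold OscillatorChain.dPotential
  rw [Finset.sum_eq_single a]
  · rw [Finset.sum_eq_single b]
    · have hba : b ≠ a := fun h => by have := congrArg Fin.val h; omega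
      simp [hab, hba.symm]
    · intro l _ hl
      have hl1 : ¬ (l.val = a.val + 1) := fun h => hl (Fin.ext (by omega))
      simp only [hl1, if_false]
    · intro h; exact absurd (Finset.mem_univ _) h
  · intro k _ hk
    refine Finset.sum_eq_zero fun l _ => ?_
    by_cases hlk : l.val = k.val + 1
    · have hl0 : l ≠ b := fun h => by subst h; exact hk (Fin.ext (by omega))
      have hk0 : k ≠ b := fun h => by subst h; have := l.isLt; omega
      simp only [hlk, if_true, hl0, hk0, if_false, sub_self, mul_zero]
    · simp only [hlk, if_false]
  · intro h; exact absurd (Finset.mem_univ _) h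

/-- **The generator identity at the right bath site** (differentiable potentials; `b = N − 1 = a + 1`):
`L_{T_L,T_R} e = j_a − j_b + γ(T_R − p_b²)` for `e = p_b²/2 + U(q_b) + ½V(q_b − q_a)` (and `j_b ≡ 0` at the last site).
[Bonetto–Lebowitz–Rey-Bellet 2000, §5.2 eq. (23)–(25)] [folklore] -/
theorem generator_rightSiteEnergy (hU : Differentiable ℝ P.U) (hV : Differentiable ℝ P.V) (hab : b.val = a.val + 1)
    (hbN : b.val + 1 = N) (T_L T_R : ℝ) (x : PhaseSpace N) :
    P.generator N T_L T_R (fun z : PhaseSpace N => (z.2 b) ^ 2 / 2 + P.U (z.1 b) + P.V (z.1 b - z.1 a) / 2) x =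
      P.bondCurrent N a x - P.bondCurrent N b x + P.γ * (T_R - (x.2 b) ^ 2) := by
  have hb0 : b.val ≠ 0 := by omega
  have hbN' : b.val = N - 1 := by omega
  have hS1 : ∑ i : Fin N, x.2 i * partialQ i (fun z : PhaseSpace N => (z.2 b) ^ 2 / 2 + P.U (z.1 b) +
      P.V (z.1 b - z.1 a) / 2) x =
      x.2 b * deriv P.U (x.1 b) + deriv P.V (x.1 b - x.1 a) / 2 * (x.2 b - x.2 a) := by
    simp only [partialQ_rightSiteEnergy P hU hV, mul_add, mul_sub, Finset.sum_add_distrib, Finset.sum_sub_distrib, mul_ite,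
      mul_one, mul_zero, Finset.sum_ite_eq', Finset.mem_univ, if_true]
    ring
  have hS2 : ∑ i : Fin N, partialQ i (P.hamiltonian N) x * partialP i (fun z : PhaseSpace N => (z.2 b) ^ 2 / 2 +
      P.U (z.1 b) + P.V (z.1 b - z.1 a) / 2) x = (deriv P.U (x.1 b) + deriv P.V (x.1 b - x.1 a)) * x.2 b := by
    simp only [partialP_rightSiteEnergy P, P.partialQ_hamiltonian_eq_dPotential hU hV, mul_ite, mul_zero,
      Finset.sum_ite_eq', Finset.mem_univ, if_true, dPotential_last P hab hbN]
  have hS3 : ∑ i : Fin N, ((if i.val = 0 then T_L * partialP i (partialP i (fun z : PhaseSpace N =>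
      (z.2 b) ^ 2 / 2 + P.U (z.1 b) + P.V (z.1 b - z.1 a) / 2)) x -
        x.2 i * partialP i (fun z : PhaseSpace N => (z.2 b) ^ 2 / 2 + P.U (z.1 b) + P.V (z.1 b - z.1 a) / 2) x else 0) +
      (if i.val = N - 1 then T_R * partialP i (partialP i (fun z : PhaseSpace N =>
        (z.2 b) ^ 2 / 2 + P.U (z.1 b) + P.V (z.1 b - z.1 a) / 2)) x -
        x.2 i * partialP i (fun z : PhaseSpace N => (z.2 b) ^ 2 / 2 + P.U (z.1 b) + P.V (z.1 b - z.1 a) / 2) x else 0)) =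
      T_R - (x.2 b) ^ 2 := by
    rw [Finset.sum_eq_single b]
    · simp only [partialP_rightSiteEnergy P, partialP_partialP_rightSiteEnergy P, if_true]
      rw [if_neg hb0, if_pos hbN']
      ring
    · intro i _ hi
      simp only [partialP_rightSiteEnergy P, partialP_partialP_rightSiteEnergy P]
      simp [hi]
    · intro h; exact absurd (Finset.mem_univ _) h
  unfold OscillatorChain.generator
  rw [Finset.sum_sub_distrib, hS1, hS2, hS3, bondCurrent_siteZero P (i0 := a) (i1 := b) hab x,
    P.bondCurrent_eq_zero_of_last N b hbN x]
  ring

end RightSite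

/-! ### The item -/

/-- **`HonestZwanzig.GeneratorSiteEnergy`, PROVED** (item stmt-AtomisticToContinuum-12698): for the pinned anharmonic
chain, `N ≥ 2` and every site `x`,
`L e_x = j_{x−1} − j_x + [x = 0] γ(T_L − p_0²) + [x = N−1] γ(T_R − p²_{N−1})` pointwise, for the symmetrically split
site energy `e_x = p_x²/2 + U(q_x) + ½V(q_{x+1} − q_x) + ½V(q_x − q_{x−1})` and BLR's bond current — case analysis on
`x` (left bath site, interior site, right bath site) and one-variable calculus of polynomials.
[Bonetto–Lebowitz–Rey-Bellet 2000, §5.2 eq. (23)–(25)] [folklore] -/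
theorem generatorSiteEnergy_proof : Summit.AtomisticToContinuum.FouriersLaw.Theses.HonestZwanzig.GeneratorSiteEnergy := by
  intro ω₂ lam β γ N hN T_L T_R x z
  dsimp only
  set P := pinnedChain ω₂ lam β γ with hP
  have hU : Differentiable ℝ P.U := (pinnedChain_contDiff_U ω₂ lam β γ (n := 1)).differentiable one_ne_zero
  have hV : Differentiable ℝ P.V := (pinnedChain_contDiff_V ω₂ lam β γ (n := 1)).differentiable one_ne_zero
  -- the current sum on the right-hand side
  have hcur : ∑ b : Fin N, ((if x.val = b.val + 1 then P.bondCurrent N b z else 0) -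
      (if b = x then P.bondCurrent N b z else 0)) =
      (∑ b : Fin N, (if x.val = b.val + 1 then P.bondCurrent N b z else 0)) - P.bondCurrent N x z := by
    rw [Finset.sum_sub_distrib, Fintype.sum_ite_eq']
  rw [hcur]
  by_cases hx0 : x.val = 0
  · -- the left bath site
    have hxN : ¬ (x.val = N - 1) := by omega
    set c : Fin N := ⟨1, by omega⟩ with hc
    have hc1 : c.val = x.val + 1 := by simp [hc, hx0]
    have hfun : (fun w : PhaseSpace N => w.2 x ^ 2 / 2 + P.U (w.1 x) +
        ∑ j : Fin N, ((if j.val = x.val + 1 then P.V (w.1 j - w.1 x) / 2 else 0) +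
          (if x.val = j.val + 1 then P.V (w.1 x - w.1 j) / 2 else 0))) =
        fun w : PhaseSpace N => (w.2 x) ^ 2 / 2 + P.U (w.1 x) + P.V (w.1 c - w.1 x) / 2 := by
      funext w
      rw [Finset.sum_add_distrib, sum_ite_val_succ_eq hc1, sum_ite_val_pred_eq_zero hx0, add_zero]
    rw [hfun, generator_siteEnergy P hU hV hx0 (by simp [hc]) T_L T_R z, sum_ite_val_pred_eq_zero hx0, if_pos hx0,
      if_neg hxN]
    ring
  by_cases hxN : x.val = N - 1
  · -- the right bath site
    set a : Fin N := ⟨N - 2, by omega⟩ with ha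
    have hxa : x.val = a.val + 1 := by simp [ha]; omega
    have hxN' : x.val + 1 = N := by omega
    have hfun : (fun w : PhaseSpace N => w.2 x ^ 2 / 2 + P.U (w.1 x) +
        ∑ j : Fin N, ((if j.val = x.val + 1 then P.V (w.1 j - w.1 x) / 2 else 0) +
          (if x.val = j.val + 1 then P.V (w.1 x - w.1 j) / 2 else 0))) =
        fun w : PhaseSpace N => (w.2 x) ^ 2 / 2 + P.U (w.1 x) + P.V (w.1 x - w.1 a) / 2 := by
      funext w
      rw [Finset.sum_add_distrib, sum_ite_val_succ_eq_zero hxN', sum_ite_val_pred_eq hxa, zero_add]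
    rw [hfun, generator_rightSiteEnergy P hU hV hxa hxN' T_L T_R z, sum_ite_val_pred_eq hxa, if_neg hx0, if_pos hxN]
    ring
  · -- an interior site
    set a : Fin N := ⟨x.val - 1, by omega⟩ with ha
    set c : Fin N := ⟨x.val + 1, by omega⟩ with hc
    have hxa : x.val = a.val + 1 := by simp [ha]; omega
    have hc1 : c.val = x.val + 1 := by simp [hc]
    have hfun : (fun w : PhaseSpace N => w.2 x ^ 2 / 2 + P.U (w.1 x) +
        ∑ j : Fin N, ((if j.val = x.val + 1 then P.V (w.1 j - w.1 x) / 2 else 0) +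
          (if x.val = j.val + 1 then P.V (w.1 x - w.1 j) / 2 else 0))) =
        fun w : PhaseSpace N => (w.2 x) ^ 2 / 2 + P.U (w.1 x) + P.V (w.1 c - w.1 x) / 2 + P.V (w.1 x - w.1 a) / 2 := by
      funext w
      rw [Finset.sum_add_distrib, sum_ite_val_succ_eq hc1, sum_ite_val_pred_eq hxa]
      ring
    rw [hfun, generator_splitSiteEnergy P hU hV hxa hc1 T_L T_R z, sum_ite_val_pred_eq hxa, if_neg hx0, if_neg hxN]
    ring

end Summit.AtomisticToContinuum.FouriersLaw.Theorems.HonestZwanzig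

end
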